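import Summits.HodgeConjecture.CorCM.CMAbelianFourfoldPowers
import Summits.HodgeConjecture.CorCM.DistinctPrimeDimensionsCMHodge
import Summits.HodgeConjecture.CorCM.MumfordTateRankOfCMAbelianVariety
import Summits.HodgeConjecture.CorCM.MumfordTateRankEllipticProducts
import Summits.HodgeConjecture.CorCM.MumfordTateRankCMCurveTimesThreefold
import Literature.AlgebraicGeometry.Motives.AbelianVarietyEndAlgebraIsogenyInvariance
import HarnessLib

/-!
# CM elliptic curve × simple CM abelian THREEFOLD: `t = 4 ⟺ End⁰E ↪ End⁰T`, `t = 5 ⟺ End⁰E ↛ End⁰T` — the Mumford–Tate rank of the last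
# CM × CM cell of the fourfold table, read off seat b16's prime-slot criterion (Moonen–Zarhin 1999 Thm. (0.1), case (a) with a CM threefold)

COR-CM (cell `pub-hodgecm2`, seat `b27` gen 49, count-neutral Mumford–Tate-rank ladder; theorems only, no definition, no named fact;
UNCONDITIONAL — nothing here uses or asserts HC_CM).  Notation `t(X) = dim MT(H¹X)`.

`CorCM/MumfordTateRankCMCurveTimesThreefold` left the cell `E × T`, `E` a CM elliptic curve, `T` a SIMPLE CM threefold, at `t ∈ {4, 5}`.
Moonen–Zarhin's case (a) («`X₁` an elliptic curve with CM by `k`, `X₂` a simple abelian threefold with `k ↪ End⁰(X₂)`») includes CM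
threefolds: `t = 4` exactly when `k = End⁰E` embeds in the sextic CM field `End⁰T`.  Seat b16's
`isNondegenerateFamily_iff_primeDim_simple_dim_le_three` (`CorCM/DistinctPrimeDimensionsCMHodge`, prime slot `p = 3` against a curve) says
that a two-slot family (simple CM threefold, CM curve) is nondegenerate iff no imaginary quadratic subfield of the sextic field maps to the
quadratic one; this file transports it to ABSTRACT `E`, `T` exactly as `CorCM/MumfordTateRankCMSurfaceTimesCMThreefold` does (Milne's
regrouping of `X ∼ E × T` has the two slots `∼ E`, `∼ T` by uniqueness of simple isogeny factors; nondegeneracy is `t = 1 + 3 + 1`;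
`End⁰ ≅ K` for simple realisations, `End⁰` is an isogeny invariant):

* **`mtRank_hodge_one_eq_five_iff_isEmpty_ringHom_of_isIsogenous_cmCurve_prod_isSimple_cmThreefold`** — `t(X) = 5 ⟺ IsEmpty (End⁰E →+* End⁰T)`;
* **`mtRank_hodge_one_eq_four_iff_nonempty_ringHom_of_isIsogenous_cmCurve_prod_isSimple_cmThreefold`** — `t(X) = 4 ⟺ Nonempty (End⁰E →+* End⁰T)`.

With the rows `23 / 11 / 10 ⟺ End⁰E ↪ End⁰T, 11 ⟺ End⁰E ↛ End⁰T` (`…CMCurveTimesThreefold`, `…TimesCMCurve`, `…TimesCMCurveSameField`) the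
column CM curve × simple threefold of the fourfold table is now decided in every case by `End⁰T` and one bit (`End⁰E ↪ End⁰T`).

## References
* [MoonenZarhin1999LowDim] B. Moonen, Yu. G. Zarhin, *Hodge classes on abelian varieties of low dimension*, Math. Ann. 315 (1999), Thm. (0.1) (a),
  §3 Prop. (3.8) [corpus: paper:arxiv-math_9901113 pp. 1, 7]. [cite: MoonenZarhin1999LowDim, Thm. (0.1) and §3 Prop. (3.8)]
* [Gordon1999HodgeAVSurvey] B. B. Gordon, *A survey of the Hodge conjecture for abelian varieties*, 7.5–7.7, 9.1. [cite: Gordon1999HodgeAVSurvey, 7.5 and 9.1]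
* [MumfordAV1970] D. Mumford, *Abelian Varieties* (1970), §19 Thm. 1, Cor. 1–2. [cite: MumfordAV1970, §19 Cor. 1 of Thm. 1]
* [Shimura1998] G. Shimura, *Abelian Varieties with Complex Multiplication and Modular Functions*, §5.1 Prop. 6 (`End⁰ = K` for a simple
  realisation). [cite: Shimura1998, §5.1 Prop. 6]
-/

noncomputable section

open CategoryTheory CategoryTheory.Limits NumberField Module
open scoped BigOperators

namespace Summit.HodgeConjecture.CorCM

open Literature.NumberTheory.ComplexMultiplication
open Literature.AlgebraicGeometry.Motives
open Literature.AlgebraicGeometry.Motives.AbelianVariety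
open Literature.AlgebraicGeometry.HodgeTheory
open Literature.AlgebraicGeometry.ComplexMultiplication (IsCMTypeRealisation)
open Literature.AlgebraicGeometry.Milne1999
open Literature.AlgebraicGeometry.Pohlmann1968
open Summit.HodgeConjecture.CorCM.Domination
open Summit.HodgeConjecture.HodgeConjecture.Ring2.Atlas (nonempty_ringEquiv_endAlgebra_of_isSimple)

variable [HodgeTensorFacts.{0, 0}] {X : AbelianVariety ℂ} {n : ℕ}

omit [HodgeTensorFacts.{0, 0}] in
/-- A number field isomorphic to a totally complex one is totally complex. [folklore] -/
private theorem isTotallyComplex_of_ringEquiv {k F : Type*} [Field k] [NumberField k] [Field F] [NumberField F] [IsTotallyComplex k]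
    (e : k ≃+* F) : IsTotallyComplex F := by
  refine ⟨fun w => ?_⟩
  rw [← InfinitePlace.not_isReal_iff_isComplex]
  rintro ⟨φ, hφ, -⟩
  have hreal : ComplexEmbedding.IsReal (φ.comp e.toRingHom) := by
    rw [ComplexEmbedding.isReal_iff] at hφ ⊢
    ext x
    have h := RingHom.congr_fun hφ (e x)
    rw [ComplexEmbedding.conjugate_coe_eq] at h ⊢
    simpa using h
  have hw : (InfinitePlace.mk (φ.comp e.toRingHom)).IsReal := ⟨_, hreal, rfl⟩
  exact (InfinitePlace.not_isReal_iff_isComplex.2 (IsTotallyComplex.isComplex _)) hw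

/-- **CM elliptic curve × simple CM threefold: `t = 5 ⟺` no ring homomorphism `End⁰E → End⁰T`** (`Hg(E × T) = Hg(E) × Hg(T) = U_k × U_K` iff
the imaginary quadratic field `k = End⁰E` does not embed in the sextic CM field `K = End⁰T`; otherwise the diagonal `k`-action is of Weil type
`(2,2)` and `Hg(E × T) ⊊ Hg(E) × Hg(T)`, Moonen–Zarhin's case (a)).  Milne's regrouping of `X` has the two slots `∼ E`, `∼ T`; seat b16's
`isNondegenerateFamily_iff_primeDim_simple_dim_le_three` (prime slot `3` against a curve) and `isNondegenerateFamily_iff_mtRank_hodge_one_eq`.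
[cite: MoonenZarhin1999LowDim, Thm. (0.1) and §3 Prop. (3.8)] [cite: Gordon1999HodgeAVSurvey, 7.5 and 9.1] [cite: Shimura1998, §5.1 Prop. 6] -/
theorem mtRank_hodge_one_eq_five_iff_isEmpty_ringHom_of_isIsogenous_cmCurve_prod_isSimple_cmThreefold (hX : IsSmoothProjective n X.X)
    {E T : AbelianVariety ℂ} (hE1 : E.dim = 1) (hEcm : IsOfCMType E) (hTs : T.IsSimple) (hT3 : T.dim = 3) (hTcm : IsOfCMType T)
    (hXP : IsIsogenous X (E.prod T)) :
    haveI := BettiUniverse.finite hX 1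
    (BettiUniverse.hodge exists_isReal_hodgeModel_holds hX 1).mtRank = 5 ↔ IsEmpty (E.endAlgebra →+* T.endAlgebra) := by
  classical
  haveI := BettiUniverse.finite hX 1
  have hEs : E.IsSimple := isSimple_of_dim_le_one hE1.le
  obtain ⟨g, hg⟩ := hXP
  have h0 : 0 < X.dim := by rw [dim_eq_of_isIsogeny hg, dim_prod]; omega
  have hcm : IsOfCMType X := (isOfCMType_iff_of_isIsogenous ⟨g, hg⟩).2 (isOfCMType_prod_iff.2 ⟨hEcm, hTcm⟩)
  -- Milne's regrouping with simple, pairwise non-isogenous representatives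
  obtain ⟨C, _, K', _, _, _, Φ', A', ι', θ', m, cls, f, hA, hs, hniso, hcls, hf⟩ :=
    exists_isIsogeny_biproduct_of_isSimple_of_isOfCMType h0 hcm
  -- `E × T ∼ ⨁ ![E, T]`, and every representative is dominated by it
  obtain ⟨g₂, hg₂⟩ := prod_isIsogenous_biproduct_two E T
  have hF : ∀ j : Fin 2, ((![E, T] : Fin 2 → AbelianVariety ℂ) j).IsSimple := fun j => by
    fin_cases j
    · exact hEs
    · exact hTs
  have hdom : ∀ c, AVDominatedBy (A' c) (⨁ fun j : Fin 2 => (![E, T] : Fin 2 → AbelianVariety ℂ) j) := by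
    intro c
    obtain ⟨j, rfl⟩ := hcls c
    exact ((((avDominatedBy_biproduct_summand (fun i => A' (cls i)) j).trans_isIsogeny_inv hf).trans_isIsogeny_hom hg)
      ).trans_isIsogeny_hom hg₂
  have hdimpos : ∀ c, 0 < (A' c).dim := fun c => by
    have h := finrank_eq_two_mul_dim_of_isCMTypeRealisation (hA c)
    have hpos : 0 < finrank ℚ (K' c) := Module.finrank_pos
    omega
  have hrep : ∀ c, IsIsogenous (A' c) E ∨ IsIsogenous (A' c) T := fun c => by
    obtain ⟨j, hj⟩ := exists_isIsogenous_of_isSimple_of_avDominatedBy_biproduct hF (hs c) (hdimpos c) (hdom c)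
    fin_cases j
    · exact Or.inl hj
    · exact Or.inr hj
  -- the slots of `E` and of `T`
  have hEX : AVDominatedBy E X := (SliceExhaustion.avDominatedBy_prod_left E T).trans_isIsogeny_inv hg
  have hTX : AVDominatedBy T X := (avDominatedBy_prod_right E T).trans_isIsogeny_inv hg
  obtain ⟨j₀, hj₀⟩ := exists_isIsogenous_of_isSimple_of_avDominatedBy_biproduct (fun j => hs (cls j)) hEs (by omega)
    (hEX.trans_isIsogeny_hom hf)
  obtain ⟨j₁, hj₁⟩ := exists_isIsogenous_of_isSimple_of_avDominatedBy_biproduct (fun j => hs (cls j)) hTs (by omega)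
    (hTX.trans_isIsogeny_hom hf)
  set cE := cls j₀ with hcE
  set cT := cls j₁ with hcT
  have hdE : (A' cE).dim = 1 := by
    obtain ⟨u, hu⟩ := hj₀
    rw [← hE1, dim_eq_of_isIsogeny hu]
  have hdT : (A' cT).dim = 3 := by
    obtain ⟨u, hu⟩ := hj₁
    rw [← hT3, dim_eq_of_isIsogeny hu]
  have h01 : cT ≠ cE := fun h => by
    have h' := hdT
    rw [h, hdE] at h'
    omega
  have hI : ∀ c, c = cT ∨ c = cE := by
    intro c
    rcases hrep c with hcS | hcT'
    · right
      by_contra hne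
      exact hniso c cE hne (hcS.trans hj₀)
    · left
      by_contra hne
      exact hniso c cT hne (hcT'.trans hj₁)
  haveI : Nonempty C := ⟨cE⟩
  -- b16's criterion and the rank dictionary
  have hcrit := isNondegenerateFamily_iff_primeDim_simple_dim_le_three (Φ := Φ') h01 hI Nat.prime_three (by norm_num) hA hdT
    (by rw [hdE]; norm_num) (by rw [hdE]; norm_num) hs
  have hrank := isNondegenerateFamily_iff_mtRank_hodge_one_eq hA hcls hX ⟨f, hf⟩
  have huniv : (Finset.univ : Finset C) = {cT, cE} := by
    ext c
    simp only [Finset.mem_univ, Finset.mem_insert, Finset.mem_singleton, true_iff]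
    exact hI c
  rw [huniv, Finset.sum_pair h01, hdT, hdE] at hrank
  -- `t = 5 ↔ nondegenerate ↔ no quadratic totally complex `F ≤ K_T` mapping to `K_E``
  rw [show (3 + 1 + 1 : ℕ) = 5 from rfl] at hrank
  rw [← hrank, hcrit]
  -- the dictionary `End⁰E ≅ K_E`, `End⁰T ≅ K_T`
  obtain ⟨eE⟩ := nonempty_ringEquiv_endAlgebra_of_isSimple (hA cE) (hs cE)
  obtain ⟨eT⟩ := nonempty_ringEquiv_endAlgebra_of_isSimple (hA cT) (hs cT)
  obtain ⟨aE⟩ := hj₀.nonempty_endAlgebra_algEquiv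
  obtain ⟨aT⟩ := hj₁.nonempty_endAlgebra_algEquiv
  -- `K_E` has degree `2` and is totally complex
  have hKE2 : finrank ℚ (K' cE) = 2 := by rw [finrank_eq_two_mul_dim_of_isCMTypeRealisation (hA cE), hdE]
  haveI : IsTotallyComplex (K' cE) := CMTypeLattice.isTotallyComplex_of_cmType (Φ' cE)
  constructor
  · -- no such `F`: no ring homomorphism `End⁰E → End⁰T`
    intro hno
    refine ⟨fun φ => hno ?_⟩
    -- `K_E → K_T`
    let gK : K' cE →+* K' cT :=
      eT.symm.toRingHom.comp (aT.toRingEquiv.toRingHom.comp (φ.comp (aE.symm.toRingEquiv.toRingHom.comp eE.toRingHom)))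
    let gA : K' cE →ₐ[ℚ] K' cT := gK.toRatAlgHom
    refine ⟨gA.fieldRange, ?_, ?_, ⟨gA.equivFieldRange.symm.toRingEquiv.toRingHom⟩⟩
    · rw [← hKE2]
      exact gA.equivFieldRange.toLinearEquiv.finrank_eq.symm
    · exact isTotallyComplex_of_ringEquiv (gA.equivFieldRange : K' cE ≃ₐ[ℚ] gA.fieldRange).toRingEquiv
  · -- a ring homomorphism `End⁰E → End⁰T` gives such an `F`
    rintro ⟨hφ⟩ ⟨F, hF2, hFc, ⟨j⟩⟩
    -- `j : F → K_E` is bijective (both of degree `2`)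
    let jA : F →ₐ[ℚ] K' cE := j.toRatAlgHom
    have hbij : Function.Bijective jA := by
      refine ⟨jA.toRingHom.injective, ?_⟩
      have hinj : Function.Injective jA.toLinearMap := jA.toRingHom.injective
      exact (LinearMap.injective_iff_surjective_of_finrank_eq_finrank (by rw [hF2, hKE2])).1 hinj
    let eF : F ≃ₐ[ℚ] K' cE := AlgEquiv.ofBijective jA hbij
    -- `End⁰E ≅ K_E ≅ F ⊆ K_T ≅ End⁰T`
    exact hφ (aT.symm.toRingEquiv.toRingHom.comp (eT.toRingHom.comp ((algebraMap F (K' cT)).comp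
      (eF.symm.toRingEquiv.toRingHom.comp (eE.symm.toRingHom.comp aE.toRingEquiv.toRingHom)))))

/-- **CM elliptic curve × simple CM threefold: `t = 4 ⟺` there is a ring homomorphism `End⁰E → End⁰T`** (`t ∈ {4, 5}`,
`CorCM/MumfordTateRankCMCurveTimesThreefold`; Moonen–Zarhin's exceptional case (a) with a CM threefold: the Weil classes of the diagonal action of
`k = End⁰E ⊂ End⁰T`). [cite: MoonenZarhin1999LowDim, Thm. (0.1) and §3 Prop. (3.8)] [cite: Gordon1999HodgeAVSurvey, 7.5 and 9.1] -/
theorem mtRank_hodge_one_eq_four_iff_nonempty_ringHom_of_isIsogenous_cmCurve_prod_isSimple_cmThreefold (hX : IsSmoothProjective n X.X)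
    {E T : AbelianVariety ℂ} (hE1 : E.dim = 1) (hEcm : IsOfCMType E) (hTs : T.IsSimple) (hT3 : T.dim = 3) (hTcm : IsOfCMType T)
    (hXP : IsIsogenous X (E.prod T)) :
    haveI := BettiUniverse.finite hX 1
    (BettiUniverse.hodge exists_isReal_hodgeModel_holds hX 1).mtRank = 4 ↔ Nonempty (E.endAlgebra →+* T.endAlgebra) := by
  have h5 := mtRank_hodge_one_eq_five_iff_isEmpty_ringHom_of_isIsogenous_cmCurve_prod_isSimple_cmThreefold hX hE1 hEcm hTs hT3 hTcm hXP
  have h45 := mtRank_hodge_one_mem_of_isIsogenous_cmCurve_prod_isSimple_cmThreefold hX hE1 hEcm hTs hT3 hTcm hXP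
  rw [← not_isEmpty_iff, ← h5]
  constructor
  · intro h4 h5'
    omega
  · intro hne
    rcases h45 with h | h
    · exact h
    · exact absurd h hne

end Summit.HodgeConjecture.CorCM

end
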